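import Literature.NumberTheory.Automorphic.IrreducibleClassesConstituents        -- ★ `IrrClass.IsConstituentOf` API (`of_injective`, `isConstituentOf_mk`)
import Literature.NumberTheory.Automorphic.MatrixCoefficientsTrivialRep            -- ★ `mem_contragredient_twist`; brings `MatrixCoefficients` (`twist_twist`, `matrixCoeff_twist`)
import Literature.NumberTheory.Rogawski1990.U3PrincipalSeriesReducibility          -- ★ `IrrClass.IsSquareIntegrable`
import HarnessLib

/-!
# Twisting classes, constituents and square-integrability by a smooth character
# (Bushnell–Henniart 2006 §9.5 (9.5.1) p. 65 «`π ↦ χπ`»; §17.4; Casselman 1995 §2.5)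

Topic `NumberTheory/Automorphic`; namespaces `Representation` ∕ `Literature.NumberTheory.Automorphic.IrrClass` (dot-notation companions of
★ `IrreducibleClasses` — `IrrClass.twist`, `Representation.subrepresentationTwistOrderIso`, `Representation.Equiv.twist`).  PROOF FILE: theorems
only (no definition, no instance, no notation, no named fact, no `sorry`).

For a topological group `G`, a character `χ : G →* ℂˣ` with open kernel (so that `IrrClass.twist χ hχ : Irr(G) → Irr(G)`, `⟦π⟧ ↦ ⟦π ⊗ χ⟧`, is ★-defined):

* §1 CLASS BOOKKEEPING — `IrrClass.twist_twist_eq` (`(⟦π⟧ ⊗ χ) ⊗ χ′ = ⟦π⟧ ⊗ (χχ′)`, ★ `Representation.twist_twist`), `IrrClass.twist_one_eq` (`⟦π⟧ ⊗ 1 = ⟦π⟧`),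
  `IrrClass.twist_inv_twist` ∕ `twist_twist_inv` (`χ⁻¹` undoes `χ`), `IrrClass.twist_injective`; plumbing `isOpen_ker_mul`, `ker_inv_eq`, `twist_congr`.
* §2 CONSTITUENTS — **`IsConstituentOf.twist`**: `⟦π⟧ ∈ JH(ρ) ⇒ ⟦π ⊗ χ⟧ ∈ JH(ρ ⊗ χ)` (the lattice of subrepresentations is unchanged by twisting,
  ★ `subrepresentationTwistOrderIso`, and the subquotient of the twist IS the twist of the subquotient — `Representation.Equiv.twistSubquotient` is not
  needed: the two representations on `N₁ ⁄ N₂` agree on the nose); `isConstituentOf_twist_iff`.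
* §3 SQUARE-INTEGRABILITY — **`IsSquareIntegrableModCenter.twist`**: for a UNITARY `χ` (`‖χ g‖ = 1`) the twist of a representation square-integrable
  modulo the centre is again so (`c^{ρ⊗χ}_{φ,v} = χ · c^{ρ}_{φ,v}`, ★ `matrixCoeff_twist`; smooth vectors of the dual agree, ★ `mem_contragredient_twist`);
  `isSquareIntegrableModCenter_twist_iff`; the class-level `IrrClass.isSquareIntegrable_twist_iff`.

Written as the generic input of the «ST-TWIST» step of cell pub/hodgecm-mathlib (census «EP-PAIRS» v1 §3 (3): `St_G(ψ) ⊗ μ∘det = St_G(ψμ)`, where the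
Steinberg label is «the square-integrable constituent of `i_G(χ_St(ψ))`» and `i_G(χ) ⊗ μ∘det ≅ i_G(χ·μ∘det|_T)` is ★ `areIsomorphicRep_twist_smoothIndRep`).

## References
* [BushnellHenniart2006] C. Bushnell, G. Henniart, *The local Langlands conjecture for GL(2)*, Grundlehren 335 (2006), §1.1, §2 (constituents), §9.5 (9.5.1) p. 65 (twisting
  `π ↦ χπ`), §17.4 (square-integrable mod centre).
* [Casselman1995] W. Casselman, *Introduction to the theory of admissible representations of 𝔭-adic reductive groups* (notes, 1995), §2.5 (matrix coefficients,
  square-integrability modulo the centre), §2.1.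
* [Rogawski1990] J. D. Rogawski, *Automorphic Representations of Unitary Groups in Three Variables*, Ann. of Math. Stud. 123 (1990), §12.2 (1) p. 173 (`St_G(ψ) = St_G ⊗ ψ∘det`).
-/

set_option autoImplicit false

noncomputable section

/-! ## §0 Representation level: the subquotient of a twist, square-integrability of a unitary twist -/

namespace Representation

section Subquotient

variable {k G V : Type*} [CommRing k] [Group G] [AddCommGroup V] [Module k V] (ρ : Representation k G V) (χ : G →* kˣ)

/-- A `ρ`-stable submodule is `ρ ⊗ χ`-stable (the `le_comap` side condition of Mathlib's `Representation.quotient`, transported). [cite: BushnellHenniart2006, §9.5 (9.5.1) p. 65] -/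
theorem le_comap_twist_of_le_comap {W : Submodule k V} (h : ∀ g, W ≤ W.comap (ρ g)) (g : G) : W ≤ W.comap (ρ.twist χ g) := by
  intro x hx
  rw [Submodule.mem_comap, twist_apply]
  exact W.smul_mem _ (h g hx)

/-- **The quotient of a twist is the twist of the quotient**, on the nose: `(ρ ⊗ χ) ⁄ W = (ρ ⁄ W) ⊗ χ` as representations on `V ⧸ W`.
[cite: BushnellHenniart2006, §9.5 (9.5.1) p. 65] -/
theorem quotient_twist {W : Submodule k V} (h : ∀ g, W ≤ W.comap (ρ g)) (h' : ∀ g, W ≤ W.comap (ρ.twist χ g)) :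
    (ρ.twist χ).quotient W h' = (ρ.quotient W h).twist χ := by
  ext g x
  simp only [LinearMap.coe_comp, Function.comp_apply, Submodule.mkQ_apply, quotient_apply, twist_apply, Submodule.mapQ_apply,
    Submodule.Quotient.mk_smul]

end Subquotient

section Subrep

variable {k G V : Type*} [CommRing k] [Group G] [AddCommGroup V] [Module k V] {ρ : Representation k G V} (χ : G →* kˣ)

/-- The restriction of `ρ ⊗ χ` to a stable `N` is the twist of the restriction of `ρ` (same submodule, ★ `subrepresentationTwistOrderIso`), on the nose.
[cite: BushnellHenniart2006, §9.5 (9.5.1) p. 65] -/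
theorem toRepresentation_twist (N : Subrepresentation ρ) :
    ((subrepresentationTwistOrderIso ρ χ).symm N).toRepresentation = N.toRepresentation.twist χ := by
  ext g x
  rfl

end Subrep

section L2

variable {G V : Type*} [Group G] [TopologicalSpace G] [SeparatelyContinuousMul G] [AddCommGroup V] [Module ℂ V]
  [MeasurableSpace (G ⧸ Subgroup.center G)] (μ : MeasureTheory.Measure (G ⧸ Subgroup.center G)) {ρ : Representation ℂ G V}

/-- **A UNITARY twist preserves square-integrability modulo the centre**: if `‖χ g‖ = 1` for all `g` and `χ` has open kernel, then `ρ ⊗ χ` is square-integrable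
modulo the centre as soon as `ρ` is — the smooth vectors of the duals agree (★ `mem_contragredient_twist`, through `χ⁻¹` and ★ `twist_twist`) and
`|c^{ρ⊗χ}_{φ,v}| = |χ|·|c^{ρ}_{φ,v}| = |c^{ρ}_{φ,v}|` (★ `matrixCoeff_twist`). [cite: BushnellHenniart2006, §17.4, §9.5 (9.5.1) p. 65] [cite: Casselman1995, §2.5] -/
theorem IsSquareIntegrableModCenter.twist {χ : G →* ℂˣ} (hχ : IsOpen (χ.ker : Set G)) (hχ₁ : ∀ g, ‖((χ g : ℂˣ) : ℂ)‖ = 1)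
    (h : ρ.IsSquareIntegrableModCenter μ) : (ρ.twist χ).IsSquareIntegrableModCenter μ := by
  intro φ hφ v
  -- `φ` is smooth for `ρ = (ρ ⊗ χ) ⊗ χ⁻¹`
  have hχ' : IsOpen ((χ⁻¹).ker : Set G) := by
    have : (χ⁻¹).ker = χ.ker := by
      ext g
      simp only [MonoidHom.mem_ker, MonoidHom.inv_apply, inv_eq_one]
    rw [this]
    exact hχ
  have hmul : χ * χ⁻¹ = 1 := by
    ext g
    simp only [MonoidHom.mul_apply, MonoidHom.inv_apply, mul_inv_cancel, MonoidHom.one_apply]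
  have hφ' : φ ∈ ρ.contragredient := by
    have := mem_contragredient_twist (ρ.twist χ) hχ' hφ
    rwa [twist_twist, hmul, twist_one] at this
  obtain ⟨f, hf, hdom⟩ := h φ hφ' v
  refine ⟨f, hf, fun g => ?_⟩
  rw [matrixCoeff_twist, norm_mul, hχ₁ g, one_mul]
  exact hdom g

/-- `ρ ⊗ χ` is square-integrable modulo the centre iff `ρ` is (unitary `χ` with open kernel; apply §0 to `χ` and to `χ⁻¹`).
[cite: BushnellHenniart2006, §17.4, §9.5 (9.5.1) p. 65] [cite: Casselman1995, §2.5] -/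
theorem isSquareIntegrableModCenter_twist_iff {χ : G →* ℂˣ} (hχ : IsOpen (χ.ker : Set G)) (hχ₁ : ∀ g, ‖((χ g : ℂˣ) : ℂ)‖ = 1) :
    (ρ.twist χ).IsSquareIntegrableModCenter μ ↔ ρ.IsSquareIntegrableModCenter μ := by
  refine ⟨fun h => ?_, fun h => h.twist μ hχ hχ₁⟩
  have hχ' : IsOpen ((χ⁻¹).ker : Set G) := by
    have : (χ⁻¹).ker = χ.ker := by
      ext g
      simp only [MonoidHom.mem_ker, MonoidHom.inv_apply, inv_eq_one]
    rw [this]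
    exact hχ
  have hχ₁' : ∀ g, ‖((χ⁻¹ g : ℂˣ) : ℂ)‖ = 1 := fun g => by
    rw [MonoidHom.inv_apply, Units.val_inv_eq_inv_val, norm_inv, hχ₁ g, inv_one]
  have hmul : χ * χ⁻¹ = 1 := by
    ext g
    simp only [MonoidHom.mul_apply, MonoidHom.inv_apply, mul_inv_cancel, MonoidHom.one_apply]
  have := h.twist μ hχ' hχ₁'
  rwa [twist_twist, hmul, twist_one] at this

end L2

end Representation

namespace Literature.NumberTheory.Automorphic

namespace IrrClass

universe u

variable {G : Type u} [Group G] [TopologicalSpace G] [SeparatelyContinuousMul G]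

/-! ## §1 Class bookkeeping: `⟦π⟧ ⊗ χ ⊗ χ′`, `⟦π⟧ ⊗ 1`, `χ⁻¹` undoes `χ` -/

/-- **Twists compose on classes**: `(⟦π⟧ ⊗ χ) ⊗ χ′ = ⟦π⟧ ⊗ (χχ′)` (★ `Representation.twist_twist` is an equality of representations on the same space;
the identity map is the isomorphism). [cite: BushnellHenniart2006, §9.5 (9.5.1) p. 65] -/
theorem twist_twist_eq (χ χ' : G →* ℂˣ) (hχ : IsOpen (χ.ker : Set G)) (hχ' : IsOpen (χ'.ker : Set G)) (hχχ' : IsOpen ((χ * χ').ker : Set G))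
    (c : IrrClass G) : (c.twist χ hχ).twist χ' hχ' = c.twist (χ * χ') hχχ' := by
  induction c using IrrClass.ind with
  | h r =>
    rw [twist_mk, twist_mk, twist_mk]
    refine mk_eq_mk_of_equiv (Representation.Equiv.mk (LinearEquiv.refl ℂ _) fun g => ?_)
    change LinearMap.id ∘ₗ ((r.ρ.twist χ).twist χ') g = (r.ρ.twist (χ * χ')) g ∘ₗ LinearMap.id
    rw [Representation.twist_twist, LinearMap.id_comp, LinearMap.comp_id]

/-- The kernel of a product of smooth characters contains the intersection of the kernels, so it is open when both are («the smooth characters form a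
group»). [cite: BushnellHenniart2006, §9.5 (9.5.1) p. 65] -/
theorem isOpen_ker_mul {χ χ' : G →* ℂˣ} [ContinuousMul G] (hχ : IsOpen (χ.ker : Set G)) (hχ' : IsOpen (χ'.ker : Set G)) :
    IsOpen ((χ * χ').ker : Set G) := by
  apply Subgroup.isOpen_mono (H₁ := χ.ker ⊓ χ'.ker)
  · intro g hg
    rw [Subgroup.mem_inf, MonoidHom.mem_ker, MonoidHom.mem_ker] at hg
    rw [MonoidHom.mem_ker, MonoidHom.mul_apply, hg.1, hg.2, one_mul]
  · exact hχ.inter hχ'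

omit [TopologicalSpace G] [SeparatelyContinuousMul G] in
/-- The kernel of `χ⁻¹` is the kernel of `χ` (so `χ⁻¹` is smooth when `χ` is). [cite: BushnellHenniart2006, §9.5 (9.5.1) p. 65] -/
theorem ker_inv_eq (χ : G →* ℂˣ) : (χ⁻¹).ker = χ.ker := by
  ext g
  simp only [MonoidHom.mem_ker, MonoidHom.inv_apply, inv_eq_one]

/-- `IrrClass.twist` depends on the character only (the open-kernel witness is a proof): equal characters give equal twists. [cite: BushnellHenniart2006, §9.5 (9.5.1) p. 65] -/
theorem twist_congr {χ χ' : G →* ℂˣ} (h : χ = χ') (hχ : IsOpen (χ.ker : Set G)) (hχ' : IsOpen (χ'.ker : Set G)) (c : IrrClass G) :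
    c.twist χ hχ = c.twist χ' hχ' := by
  subst h
  rfl

/-- **Twisting by the trivial character is the identity on classes.** [cite: BushnellHenniart2006, §9.5 (9.5.1) p. 65] -/
theorem twist_one_eq (h1 : IsOpen ((1 : G →* ℂˣ).ker : Set G)) (c : IrrClass G) : c.twist 1 h1 = c := by
  induction c using IrrClass.ind with
  | h r =>
    rw [twist_mk]
    refine mk_eq_mk_of_equiv (Representation.Equiv.mk (LinearEquiv.refl ℂ _) fun g => ?_)
    change LinearMap.id ∘ₗ (r.ρ.twist 1) g = r.ρ g ∘ₗ LinearMap.id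
    rw [Representation.twist_one, LinearMap.id_comp, LinearMap.comp_id]

/-- **`χ⁻¹` undoes `χ` on classes**: `(⟦π⟧ ⊗ χ) ⊗ χ⁻¹ = ⟦π⟧`. [cite: BushnellHenniart2006, §9.5 (9.5.1) p. 65] -/
theorem twist_twist_inv [ContinuousMul G] (χ : G →* ℂˣ) (hχ : IsOpen (χ.ker : Set G)) (hχ' : IsOpen ((χ⁻¹).ker : Set G)) (c : IrrClass G) :
    (c.twist χ hχ).twist χ⁻¹ hχ' = c := by
  have h1 : IsOpen ((1 : G →* ℂˣ).ker : Set G) := by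
    rw [MonoidHom.ker_one, Subgroup.coe_top]
    exact isOpen_univ
  have hmul : χ * χ⁻¹ = 1 := by
    ext g
    simp only [MonoidHom.mul_apply, MonoidHom.inv_apply, mul_inv_cancel, MonoidHom.one_apply]
  rw [twist_twist_eq χ χ⁻¹ hχ hχ' (by rw [hmul]; exact h1), twist_congr hmul _ h1 c]
  exact twist_one_eq h1 c

/-- `(⟦π⟧ ⊗ χ⁻¹) ⊗ χ = ⟦π⟧`. [cite: BushnellHenniart2006, §9.5 (9.5.1) p. 65] -/
theorem twist_inv_twist [ContinuousMul G] (χ : G →* ℂˣ) (hχ : IsOpen (χ.ker : Set G)) (hχ' : IsOpen ((χ⁻¹).ker : Set G)) (c : IrrClass G) :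
    (c.twist χ⁻¹ hχ').twist χ hχ = c := by
  have h1 : IsOpen ((1 : G →* ℂˣ).ker : Set G) := by
    rw [MonoidHom.ker_one, Subgroup.coe_top]
    exact isOpen_univ
  have hmul : χ⁻¹ * χ = 1 := by
    ext g
    simp only [MonoidHom.mul_apply, MonoidHom.inv_apply, inv_mul_cancel, MonoidHom.one_apply]
  rw [twist_twist_eq χ⁻¹ χ hχ' hχ (by rw [hmul]; exact h1), twist_congr hmul _ h1 c]
  exact twist_one_eq h1 c

/-- **Twisting by `χ` is injective on `Irr(G)`** (it has the inverse `⊗ χ⁻¹`). [cite: BushnellHenniart2006, §9.5 (9.5.1) p. 65] -/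
theorem twist_injective [ContinuousMul G] (χ : G →* ℂˣ) (hχ : IsOpen (χ.ker : Set G)) : Function.Injective (IrrClass.twist χ hχ) := by
  intro c c' h
  have hχ' : IsOpen ((χ⁻¹).ker : Set G) := by rw [ker_inv_eq]; exact hχ
  rw [← twist_twist_inv χ hχ hχ' c, ← twist_twist_inv χ hχ hχ' c', h]

/-! ## §2 Constituents of a twist -/

/-- **`⟦π⟧ ∈ JH(ρ) ⇒ ⟦π ⊗ χ⟧ ∈ JH(ρ ⊗ χ)`**: the subrepresentations `N₂ ≤ N₁` of `ρ` exhibiting `π ≅ N₁ ⁄ N₂` are subrepresentations of `ρ ⊗ χ`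
(★ `subrepresentationTwistOrderIso`), the subquotient of `ρ ⊗ χ` they cut out IS `(N₁ ⁄ N₂) ⊗ χ` (§0 `quotient_twist`, `toRepresentation_twist`), and
`π ⊗ χ ≅ (N₁ ⁄ N₂) ⊗ χ` (★ `Equiv.twist`). [cite: BushnellHenniart2006, §2, §9.5 (9.5.1) p. 65] -/
theorem IsConstituentOf.twist {V : Type*} [AddCommGroup V] [Module ℂ V] {ρ : Representation ℂ G V} {c : IrrClass G}
    (h : c.IsConstituentOf ρ) (χ : G →* ℂˣ) (hχ : IsOpen (χ.ker : Set G)) : (c.twist χ hχ).IsConstituentOf (ρ.twist χ) := by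
  obtain ⟨r, rfl, N₁, N₂, hle, ⟨e⟩⟩ := h
  refine ⟨r.twist χ hχ, (twist_mk χ hχ r).symm, (Representation.subrepresentationTwistOrderIso ρ χ).symm N₁,
    (Representation.subrepresentationTwistOrderIso ρ χ).symm N₂, hle, ⟨?_⟩⟩
  -- the target subquotient is the twist of the source subquotient, on the nose
  have key : ((Representation.subrepresentationTwistOrderIso ρ χ).symm N₁).toRepresentation.quotient
      ((((Representation.subrepresentationTwistOrderIso ρ χ).symm N₂).toSubmodule).comap
        ((Representation.subrepresentationTwistOrderIso ρ χ).symm N₁).toSubmodule.subtype)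
      (fun g _ hx ↦ ((Representation.subrepresentationTwistOrderIso ρ χ).symm N₂).apply_mem_toSubmodule g hx) =
      (N₁.toRepresentation.quotient (N₂.toSubmodule.comap N₁.toSubmodule.subtype)
        (fun g _ hx ↦ N₂.apply_mem_toSubmodule g hx)).twist χ := by
    ext g x
    rfl
  rw [SmoothIrrep.ρ_twist, key]
  exact e.twist χ

/-- `⟦π⟧ ⊗ χ ∈ JH(ρ ⊗ χ) ⇔ ⟦π⟧ ∈ JH(ρ)` (§2 applied to `χ` and to `χ⁻¹`, §1 `twist_twist_inv`, ★ `Representation.twist_twist`).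
[cite: BushnellHenniart2006, §2, §9.5 (9.5.1) p. 65] -/
theorem isConstituentOf_twist_iff [ContinuousMul G] {V : Type*} [AddCommGroup V] [Module ℂ V] {ρ : Representation ℂ G V} {c : IrrClass G}
    (χ : G →* ℂˣ) (hχ : IsOpen (χ.ker : Set G)) : (c.twist χ hχ).IsConstituentOf (ρ.twist χ) ↔ c.IsConstituentOf ρ := by
  refine ⟨fun h => ?_, fun h => h.twist χ hχ⟩
  have hχ' : IsOpen ((χ⁻¹).ker : Set G) := by rw [ker_inv_eq]; exact hχ
  have hmul : χ * χ⁻¹ = 1 := by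
    ext g
    simp only [MonoidHom.mul_apply, MonoidHom.inv_apply, mul_inv_cancel, MonoidHom.one_apply]
  have := h.twist χ⁻¹ hχ'
  rwa [twist_twist_inv χ hχ hχ' c, Representation.twist_twist, hmul, Representation.twist_one] at this

/-! ## §3 Square-integrability of a twist (class level) -/

end IrrClass

namespace IrrClass

variable {G : Type} [Group G] [TopologicalSpace G] [SeparatelyContinuousMul G] [ContinuousMul G]
  [MeasurableSpace (G ⧸ Subgroup.center G)] (μZ : MeasureTheory.Measure (G ⧸ Subgroup.center G))

/-- **`⟦π ⊗ χ⟧` is square-integrable modulo the centre iff `⟦π⟧` is**, for a UNITARY `χ` with open kernel (★ `IrrClass.IsSquareIntegrable` = «some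
representative is»; §0 on representatives, `χ⁻¹` for the converse). [cite: BushnellHenniart2006, §17.4, §9.5 (9.5.1) p. 65] [cite: Casselman1995, §2.5] [cite: Rogawski1990, §12.2 (1) p. 173] -/
theorem isSquareIntegrable_twist_iff {χ : G →* ℂˣ} (hχ : IsOpen (χ.ker : Set G)) (hχ₁ : ∀ g, ‖((χ g : ℂˣ) : ℂ)‖ = 1) (c : IrrClass G) :
    (c.twist χ hχ).IsSquareIntegrable μZ ↔ c.IsSquareIntegrable μZ := by
  have hχ' : IsOpen ((χ⁻¹).ker : Set G) := by rw [ker_inv_eq]; exact hχ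
  have hχ₁' : ∀ g, ‖((χ⁻¹ g : ℂˣ) : ℂ)‖ = 1 := fun g => by
    rw [MonoidHom.inv_apply, Units.val_inv_eq_inv_val, norm_inv, hχ₁ g, inv_one]
  constructor
  · rintro ⟨r', hr', h'⟩
    refine ⟨r'.twist χ⁻¹ hχ', ?_, ?_⟩
    · rw [← twist_mk, hr', twist_twist_inv χ hχ hχ' c]
    · rw [SmoothIrrep.ρ_twist]
      exact h'.twist μZ hχ' hχ₁'
  · rintro ⟨r, hr, h⟩
    refine ⟨r.twist χ hχ, ?_, ?_⟩
    · rw [← twist_mk, hr]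
    · rw [SmoothIrrep.ρ_twist]
      exact h.twist μZ hχ hχ₁

omit [ContinuousMul G] in
/-- One direction without unitarity bookkeeping on the class: a square-integrable representative of `⟦π⟧` makes `⟦π ⊗ χ⟧` square-integrable (unitary `χ`).
[cite: BushnellHenniart2006, §17.4, §9.5 (9.5.1) p. 65] -/
theorem isSquareIntegrable_twist_of_mk {χ : G →* ℂˣ} (hχ : IsOpen (χ.ker : Set G)) (hχ₁ : ∀ g, ‖((χ g : ℂˣ) : ℂ)‖ = 1)
    (r : SmoothIrrep G) (h : r.ρ.IsSquareIntegrableModCenter μZ) : ((IrrClass.mk r).twist χ hχ).IsSquareIntegrable μZ :=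
  ⟨r.twist χ hχ, by rw [← twist_mk], by rw [SmoothIrrep.ρ_twist]; exact h.twist μZ hχ hχ₁⟩

end IrrClass

end Literature.NumberTheory.Automorphic

end
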